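/-
Origin: expansion seat `planner-pub-hodgecm-prl1-g3-0`, handover #5 2026-08-18T06:05:51Z (`HOME/pub-hodgecm-prl1-g3/lean/Prl1g3/IntegratedRep.lean`, md5 85625623, 415 lines);
landed by the gen-6 packager in gate run 24 as `HodgeCM/Automorphic/IntegratedRep.lean` (import ^import Prl1g3\.→import HodgeCM.Automorphic. ×1).
-/
/-
Origin: HOME/pub-hodgecm-prl1-g3/lean/Prl1g3/IntegratedRep.lean — session planner-pub-hodgecm-prl1-g3-0
(unit pub-hodgecm-prl1-g3, EXPANSION PROVER a-1 gen 3: CONSTRUCT the realisation).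
Intended final place (packager's call): `HodgeCM/Automorphic/IntegratedRep.lean`; module renames
`Prl1g3.KoopmanUnitary` ↦ `HodgeCM.Automorphic.KoopmanUnitary` (mine, handed over before this file).
NEW, ADDITIVE; touches no existing file.

KIND: KERNEL (the integrated representation and its properties) + L2 (a finer hypothesis record whose one cited
field is `RepCoreCarrier.AnalyticD.dirac_compact`, see its docstring).  Nothing is posited.
-/
import Summits.HodgeConjecture.HodgeCM.Automorphic.KoopmanUnitary
import Mathlib.MeasureTheory.Group.Integral
import Mathlib.MeasureTheory.Function.LocallyIntegrable
import Mathlib.MeasureTheory.Integral.Bochner.ContinuousLinearMap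
import Mathlib.MeasureTheory.Function.LpSpace.DomAct.Continuous

set_option autoImplicit false

/-!
# The integrated representation `R(f) = ∫ f(g) R(g) dg` — CONSTRUCTED, and the compact approximation from it

File `DiscreteDecomposition` derived the discrete decomposition of `L²([U(W)])` from `HasCompactApprox R`: a set
of compact symmetric operators mapping every closed invariant subspace into itself and jointly moving every
non-zero vector.  Here the intended witnesses — the integrated operators `R(f_n)` of a Dirac sequence — are BUILT in
the kernel for any strongly continuous unitary representation `R` of a topological group `G` on a Hilbert space and
any measure `ν` on `G` finite on compacts, and three of the four clauses are PROVED: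

* `RepDecomp.intRep ν hR hc hf hcf : H →L[ℂ] H`, `v ↦ ∫ g, f g • R g v ∂ν` for `f ∈ C_c(G)` ([Getz–Hahn, GTM 300,
  §3.3 p. 58]: "`π(f) : V → V, φ ↦ ∫_G π(g)f(g)φ d_r g` … If `π` is unitary then this map is bounded") — bounded by
  `∫ ‖f‖`;
* `RepDecomp.intRep_mem` (KERNEL): `R(f)` maps every CLOSED `R`-invariant subspace `M` into itself
  (`⟪u, ∫ F⟫ = ∫ ⟪u, F⟫ = 0` for `u ∈ Mᗮ`, and `Mᗮᗮ = M`);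
* `RepDecomp.intRep_isSymmetric` (KERNEL): for `ν` inversion-invariant and `f` with `conj f(g⁻¹) = f(g)`, `R(f)` is
  symmetric (ibid. p. 179: "`R(f_n)` is self-adjoint for every `n` by condition (b)");
* `RepDecomp.IsDiracSeq ν φ` (ibid. §9.3 p. 179, (a)(b)(c)) and `RepDecomp.tendsto_diracOp` (KERNEL):
  `R(f_n) v → v` (ibid.: "for representations `(R, V)` of `G(𝔸_F)¹` and `φ ∈ V` one has `R(f_n)φ → φ`", Exercise 9.8),
  hence `RepDecomp.exists_diracOp_ne_zero`;
* `RepDecomp.hasCompactApprox_of_dirac` : the ONE remaining input is "`R(f_n)` is a compact operator for every `n`"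
  — verbatim the hypothesis of ibid. Lemma 9.3.1, p. 179, supplied for `[U(W)]` by Theorem 9.1.1, p. 174.
* `RepCoreCarrier.AnalyticD` = `{R_unitary, R_continuous, dirac_compact, hatτ_complete}` `→ AnalyticK → Analytic`,
  and for the `L²`/Koopman model `RepCoreCarrier.AnalyticL2D` = `{R_eq, dirac_compact, hatτ_complete}` (unitarity
  AND strong continuity are theorems: Mathlib `DomMulAct.norm_smul_Lp`, `Lp.instContinuousSMulDomMulAct`).
-/

noncomputable section

open scoped InnerProductSpace ComplexConjugate Topology ENNReal
open MeasureTheory Filter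

namespace HodgeCM
namespace RepDecomp

open HodgeCM.PerL34 HodgeCM.PerL34.Spectral

variable {H : Type*} [NormedAddCommGroup H] [InnerProductSpace ℂ H] [CompleteSpace H]
variable {G : Type*} [Group G]
variable {R : G →* (H →L[ℂ] H)}

/-! ## 1. Unitary operators are isometries; strong continuity -/

omit [CompleteSpace H] in
/-- (Ported verbatim from the HodgeCMPerL package; no docstring in the source.) -/
theorem _root_.HodgeCM.PerL34.Spectral.IsUnitaryRep.norm_map (hR : IsUnitaryRep R) (g : G) (v : H) :
    ‖R g v‖ = ‖v‖ := by
  rw [@norm_eq_sqrt_re_inner ℂ, @norm_eq_sqrt_re_inner ℂ _ _ _ _ v, hR g v v]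

variable [TopologicalSpace G]

variable (R) in
/-- Strong continuity: every orbit map `g ↦ R g v` is continuous. -/
def StronglyContinuous : Prop := ∀ v : H, Continuous fun g : G => R g v

/-! ## 2. The integrated operators `R(f)`, `f ∈ C_c(G)` -/

variable [MeasurableSpace G] [OpensMeasurableSpace G] (ν : Measure G) [IsFiniteMeasureOnCompacts ν]

omit [CompleteSpace H] in
/-- (Ported verbatim from the HodgeCMPerL package; no docstring in the source.) -/
theorem integrable_orbit (hc : StronglyContinuous R) {f : G → ℂ} (hf : Continuous f)
    (hcf : HasCompactSupport f) (v : H) : Integrable (fun g => f g • R g v) ν :=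
  (hf.smul (hc v)).integrable_of_hasCompactSupport (hcf.smul_right (f' := fun g => R g v))

/-- **The integrated operator `R(f) v = ∫ f(g) • R g v dν`** as a bounded operator (bound `∫ ‖f‖`). -/
def intRep (hR : IsUnitaryRep R) (hc : StronglyContinuous R) {f : G → ℂ} (hf : Continuous f)
    (hcf : HasCompactSupport f) : H →L[ℂ] H :=
  LinearMap.mkContinuous
    { toFun := fun v => ∫ g, f g • R g v ∂ν
      map_add' := fun u v => by
        simp only [map_add, smul_add]
        exact integral_add (integrable_orbit ν hc hf hcf u) (integrable_orbit ν hc hf hcf v)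
      map_smul' := fun a v => by
        simp only [map_smul, RingHom.id_apply]
        simp_rw [smul_comm (f _) a]
        exact integral_smul a _ }
    (∫ g, ‖f g‖ ∂ν)
    (fun v => by
      simp only [LinearMap.coe_mk, AddHom.coe_mk]
      calc ‖∫ g, f g • R g v ∂ν‖ ≤ ∫ g, ‖f g‖ * ‖v‖ ∂ν :=
            norm_integral_le_of_norm_le ((hf.norm.integrable_of_hasCompactSupport hcf.norm).mul_const _)
              (Eventually.of_forall fun g => by rw [norm_smul, hR.norm_map])
        _ = (∫ g, ‖f g‖ ∂ν) * ‖v‖ := integral_mul_const _ _)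

omit [CompleteSpace H] in
/-- (Ported verbatim from the HodgeCMPerL package; no docstring in the source.) -/
@[simp] theorem intRep_apply (hR : IsUnitaryRep R) (hc : StronglyContinuous R) {f : G → ℂ} (hf : Continuous f)
    (hcf : HasCompactSupport f) (v : H) : intRep ν hR hc hf hcf v = ∫ g, f g • R g v ∂ν := rfl

/-- **`R(f)` maps every closed `R`-invariant subspace into itself** — PROVED. -/
theorem intRep_mem (hR : IsUnitaryRep R) (hc : StronglyContinuous R) {f : G → ℂ} (hf : Continuous f)
    (hcf : HasCompactSupport f) {M : Submodule ℂ H} (hMc : IsClosed (M : Set H)) (hM : Invariant R M)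
    {v : H} (hv : v ∈ M) : intRep ν hR hc hf hcf v ∈ M := by
  haveI : CompleteSpace M := hMc.completeSpace_coe
  rw [← Submodule.orthogonal_orthogonal M, Submodule.mem_orthogonal]
  intro u hu
  rw [intRep_apply, ← integral_inner (integrable_orbit ν hc hf hcf v)]
  refine integral_eq_zero_of_ae (Eventually.of_forall fun g => ?_)
  simp only [Pi.zero_apply, inner_smul_right]
  rw [Submodule.inner_left_of_mem_orthogonal (hM g v hv) hu, mul_zero]

/-- **`R(f)` is symmetric** for inversion-invariant `ν` and `f` with `conj f(g⁻¹) = f(g)` — PROVED. -/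
theorem intRep_isSymmetric [MeasurableInv G] [ν.IsInvInvariant] (hR : IsUnitaryRep R) (hc : StronglyContinuous R)
    {f : G → ℂ} (hf : Continuous f) (hcf : HasCompactSupport f) (hsymm : ∀ g, conj (f g⁻¹) = f g) :
    (intRep ν hR hc hf hcf : H →ₗ[ℂ] H).IsSymmetric := by
  intro u v
  have hconj : ∀ g, conj (f g) = f g⁻¹ := fun g => by simpa only [inv_inv] using hsymm g⁻¹
  rw [ContinuousLinearMap.coe_coe, intRep_apply, intRep_apply,
    ← integral_inner (integrable_orbit ν hc hf hcf v) u, ← inner_conj_symm,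
    ← integral_inner (integrable_orbit ν hc hf hcf u) v, ← integral_conj,
    ← integral_inv_eq_self (fun g => ⟪u, f g • R g v⟫_ℂ) ν]
  refine integral_congr_ae (Eventually.of_forall fun g => ?_)
  simp only
  rw [inner_conj_symm, inner_smul_left, inner_smul_right, hR.inner_apply_left, hconj]

/-! ## 3. Dirac sequences and the approximation `R(f_n) v → v` -/

/-- **A Dirac sequence** on `G` for the measure `ν` — verbatim [Getz–Hahn 2024, §9.3 p. 179]: "a sequence of
nonnegative (real valued) functions `f_n ∈ C_c^∞(G(𝔸_F)¹)` indexed by `n ∈ ℤ_{>0}` such that (a) For any open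
neighborhood `U ∋ 1` in `G(𝔸_F)¹` with compact closure the support of `f_n` is contained in `U` for `n` large enough.
(b) One has `f_n(x⁻¹) = f_n(x)`.  (c) One has `∫_{G(𝔸_F)¹} f_n(x)dx = 1` for all `n`."  (`C_c^∞` is weakened to
`C_c`, which is all that is used.) -/
structure IsDiracSeq (φ : ℕ → G → ℝ) : Prop where
  cont : ∀ n, Continuous (φ n)
  cptSupport : ∀ n, HasCompactSupport (φ n)
  nonneg : ∀ n g, 0 ≤ φ n g
  /-- (a) -/
  support_small : ∀ U : Set G, IsOpen U → (1 : G) ∈ U → IsCompact (closure U) →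
    ∀ᶠ n in atTop, Function.support (φ n) ⊆ U
  /-- (b) -/
  symm : ∀ n g, φ n g⁻¹ = φ n g
  /-- (c) -/
  integral_one : ∀ n, ∫ g, φ n g ∂ν = 1

namespace IsDiracSeq

variable {ν} {φ : ℕ → G → ℝ}

omit [OpensMeasurableSpace G] [IsFiniteMeasureOnCompacts ν] in
/-- (Ported verbatim from the HodgeCMPerL package; no docstring in the source.) -/
theorem cont_complex (hφ : IsDiracSeq ν φ) (n : ℕ) : Continuous fun g => (φ n g : ℂ) :=
  Complex.continuous_ofReal.comp (hφ.cont n)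

omit [OpensMeasurableSpace G] [IsFiniteMeasureOnCompacts ν] in
/-- (Ported verbatim from the HodgeCMPerL package; no docstring in the source.) -/
theorem cptSupport_complex (hφ : IsDiracSeq ν φ) (n : ℕ) : HasCompactSupport fun g => (φ n g : ℂ) :=
  (hφ.cptSupport n).comp_left Complex.ofReal_zero

omit [OpensMeasurableSpace G] [IsFiniteMeasureOnCompacts ν] in
/-- (Ported verbatim from the HodgeCMPerL package; no docstring in the source.) -/
theorem symm_complex (hφ : IsDiracSeq ν φ) (n : ℕ) (g : G) : conj ((φ n g⁻¹ : ℝ) : ℂ) = (φ n g : ℂ) := by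
  rw [Complex.conj_ofReal, hφ.symm n g]

omit [OpensMeasurableSpace G] [IsFiniteMeasureOnCompacts ν] in
/-- (Ported verbatim from the HodgeCMPerL package; no docstring in the source.) -/
theorem integrable (hφ : IsDiracSeq ν φ) (n : ℕ) : Integrable (φ n) ν := by
  by_contra h
  have := hφ.integral_one n
  rw [integral_undef h] at this
  exact zero_ne_one this

end IsDiracSeq

variable {ν}

/-- The integrated operators `R(f_n)` of a Dirac sequence. -/
def diracOp (hR : IsUnitaryRep R) (hc : StronglyContinuous R) {φ : ℕ → G → ℝ} (hφ : IsDiracSeq ν φ) (n : ℕ) :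
    H →L[ℂ] H :=
  intRep ν hR hc (hφ.cont_complex n) (hφ.cptSupport_complex n)

omit [CompleteSpace H] in
/-- (Ported verbatim from the HodgeCMPerL package; no docstring in the source.) -/
theorem diracOp_apply (hR : IsUnitaryRep R) (hc : StronglyContinuous R) {φ : ℕ → G → ℝ} (hφ : IsDiracSeq ν φ)
    (n : ℕ) (v : H) : diracOp hR hc hφ n v = ∫ g, (φ n g : ℂ) • R g v ∂ν := rfl

/-- **`R(f_n) v → v` along a Dirac sequence** — PROVED ([Getz–Hahn 2024, p. 179 / Exercise 9.8]). -/
theorem tendsto_diracOp [R1Space G] [LocallyCompactSpace G] (hR : IsUnitaryRep R) (hc : StronglyContinuous R)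
    {φ : ℕ → G → ℝ} (hφ : IsDiracSeq ν φ) (v : H) : Tendsto (fun n => diracOp hR hc hφ n v) atTop (𝓝 v) := by
  rw [Metric.tendsto_atTop]
  intro ε hε
  -- the neighbourhood of `1` where the orbit of `v` moves by less than `ε/2`
  have hU : {g : G | ‖R g v - v‖ < ε / 2} ∈ 𝓝 (1 : G) := by
    have hcont1 : Continuous fun g : G => ‖R g v - v‖ := ((hc v).sub continuous_const).norm
    refine (hcont1.isOpen_preimage (Set.Iio (ε / 2)) isOpen_Iio).mem_nhds ?_
    show ‖R 1 v - v‖ < ε / 2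
    rw [one_apply', sub_self, norm_zero]
    exact half_pos hε
  -- an open neighbourhood of `1` with compact closure inside it (local compactness), and (a)
  obtain ⟨s, hs1, hsU, hsc⟩ := local_compact_nhds hU
  obtain ⟨N, hN⟩ := eventually_atTop.mp (hφ.support_small (interior s) isOpen_interior
    (mem_interior_iff_mem_nhds.mpr hs1) (hsc.closure_of_subset interior_subset))
  replace hN : ∀ n, N ≤ n → Function.support (φ n) ⊆ {g : G | ‖R g v - v‖ < ε / 2} :=
    fun n hn => ((hN n hn).trans interior_subset).trans hsU
  refine ⟨N, fun n hn => ?_⟩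
  have hF : Integrable (fun g => (φ n g : ℂ) • R g v) ν :=
    integrable_orbit ν hc (hφ.cont_complex n) (hφ.cptSupport_complex n) v
  have hFv : Integrable (fun g => (φ n g : ℂ) • v) ν :=
    ((hφ.cont_complex n).smul continuous_const).integrable_of_hasCompactSupport
      ((hφ.cptSupport_complex n).smul_right (f' := fun _ => v))
  have hv : ∫ g, (φ n g : ℂ) • v ∂ν = v := by
    rw [integral_smul_const, integral_complex_ofReal, hφ.integral_one n, Complex.ofReal_one, one_smul]
  have h1 : diracOp hR hc hφ n v - v = ∫ g, (φ n g : ℂ) • (R g v - v) ∂ν := by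
    simp_rw [smul_sub]
    rw [integral_sub hF hFv, hv, diracOp_apply]
  rw [dist_eq_norm, h1]
  calc ‖∫ g, (φ n g : ℂ) • (R g v - v) ∂ν‖ ≤ ∫ g, φ n g * (ε / 2) ∂ν :=
        norm_integral_le_of_norm_le ((hφ.integrable n).mul_const _) (Eventually.of_forall fun g => by
          rw [norm_smul, Complex.norm_real, Real.norm_of_nonneg (hφ.nonneg n g)]
          by_cases hg : φ n g = 0
          · simp [hg]
          · exact mul_le_mul_of_nonneg_left (le_of_lt (hN n hn (Function.mem_support.mpr hg))) (hφ.nonneg n g))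
    _ = ε / 2 := by rw [integral_mul_const, hφ.integral_one n, one_mul]
    _ < ε := half_lt_self hε

/-- Hence every non-zero vector is moved by some `R(f_n)`. -/
theorem exists_diracOp_ne_zero [R1Space G] [LocallyCompactSpace G] (hR : IsUnitaryRep R)
    (hc : StronglyContinuous R) {φ : ℕ → G → ℝ} (hφ : IsDiracSeq ν φ) {v : H} (hv : v ≠ 0) :
    ∃ n, diracOp hR hc hφ n v ≠ 0 := by
  by_contra h
  push Not at h
  have h1 := tendsto_diracOp hR hc hφ v
  simp_rw [h] at h1
  exact hv (tendsto_nhds_unique h1 tendsto_const_nhds)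

/-! ## 4. The compact approximation from compactness of the `R(f_n)` -/

/-- **`HasCompactApprox R` from the ONE print input "each `R(f_n)` is compact"** ([Getz–Hahn 2024, Lemma 9.3.1
hypothesis, p. 179]; for `[U(W)]` it is Theorem 9.1.1, p. 174): invariance, symmetry and non-degeneracy are the
theorems above. -/
theorem hasCompactApprox_of_dirac [R1Space G] [LocallyCompactSpace G] [MeasurableInv G] [ν.IsInvInvariant]
    (hR : IsUnitaryRep R) (hc : StronglyContinuous R) {φ : ℕ → G → ℝ} (hφ : IsDiracSeq ν φ)
    (hK : ∀ n, IsCompactOperator (diracOp hR hc hφ n)) : HasCompactApprox R := by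
  refine ⟨Set.range fun n => diracOp hR hc hφ n, ?_, ?_⟩
  · rintro _ ⟨n, rfl⟩
    exact ⟨hK n, intRep_isSymmetric ν hR hc _ _ (hφ.symm_complex n),
      fun M hMc hM v hv => intRep_mem ν hR hc _ _ hMc hM hv⟩
  · intro v hv
    obtain ⟨n, hn⟩ := exists_diracOp_ne_zero hR hc hφ hv
    exact ⟨_, ⟨n, rfl⟩, hn⟩

/-- The same with the compactness input stated on the bare functions `v ↦ ∫ f_n(g) • R g v dν` (no proof terms in
the hypothesis; `IsCompactOperator` is a predicate on functions). -/
theorem hasCompactApprox_of_dirac' [R1Space G] [LocallyCompactSpace G] [MeasurableInv G] [ν.IsInvInvariant]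
    (hR : IsUnitaryRep R) (hc : StronglyContinuous R) {φ : ℕ → G → ℝ} (hφ : IsDiracSeq ν φ)
    (hK : ∀ n, IsCompactOperator fun v : H => ∫ g, (φ n g : ℂ) • R g v ∂ν) : HasCompactApprox R :=
  hasCompactApprox_of_dirac hR hc hφ hK

/-- **DISCRETE DECOMPOSITION from a Dirac sequence with compact `R(f_n)`** — [Getz–Hahn 2024, Lemma 9.3.1] in full. -/
theorem discreteDecomp_of_dirac [R1Space G] [LocallyCompactSpace G] [MeasurableInv G] [ν.IsInvInvariant]
    (hR : IsUnitaryRep R) (hc : StronglyContinuous R) {φ : ℕ → G → ℝ} (hφ : IsDiracSeq ν φ)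
    (hK : ∀ n, IsCompactOperator fun v : H => ∫ g, (φ n g : ℂ) • R g v ∂ν) :
    (⨆ V : Irr R, (V.1 : Submodule ℂ H)).topologicalClosure = ⊤ :=
  discreteDecomp_of_compactApprox hR (hasCompactApprox_of_dirac' hR hc hφ hK)

end RepDecomp

/-! ## 5. The hypothesis records -/

namespace RepDecomp

/-- **A Dirac datum on a topological group `G`**: `G` is R₁ and locally compact; a measurable structure containing
the opens with measurable inversion, a measure finite on compacts and inversion-invariant, and a Dirac sequence for
it.  DATA (in the model: `U(W)(𝔸)` is a locally compact Hausdorff unimodular group — Borel structure, Haar measure —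
and [Getz–Hahn 2024, p. 179]: "It is not difficult to see that a Dirac sequence on `G(𝔸_F)¹` exists (Exercise 9.7)"). -/
structure DiracDatum (G : Type*) [Group G] [TopologicalSpace G] where
  [r1 : R1Space G]
  [locCpt : LocallyCompactSpace G]
  [mG : MeasurableSpace G]
  [opensG : OpensMeasurableSpace G]
  [invG : MeasurableInv G]
  /-- the measure -/
  ν : Measure G
  [finCpt : IsFiniteMeasureOnCompacts ν]
  [invInv : ν.IsInvInvariant]
  /-- the Dirac sequence -/
  φ : ℕ → G → ℝ
  dirac : IsDiracSeq ν φ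

namespace DiracDatum

open HodgeCM.PerL34 HodgeCM.PerL34.Spectral

variable {H : Type*} [NormedAddCommGroup H] [InnerProductSpace ℂ H] [CompleteSpace H]
variable {G : Type*} [Group G] [TopologicalSpace G] (d : DiracDatum G)

/-- The bare integrated functions `v ↦ ∫ f_n(g) • R g v dν` of the datum. -/
def opFun (R : G →* (H →L[ℂ] H)) (n : ℕ) : H → H := fun v => ∫ g, (d.φ n g : ℂ) • R g v ∂d.ν

/-- (Ported verbatim from the HodgeCMPerL package; no docstring in the source.) -/
theorem hasCompactApprox {R : G →* (H →L[ℂ] H)} (hR : IsUnitaryRep R) (hc : StronglyContinuous R)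
    (hK : ∀ n, IsCompactOperator (d.opFun R n)) : HasCompactApprox R := by
  letI := d.mG
  haveI := d.r1
  haveI := d.locCpt
  haveI := d.opensG
  haveI := d.invG
  haveI := d.finCpt
  haveI := d.invInv
  exact hasCompactApprox_of_dirac' hR hc d.dirac hK

end DiracDatum

end RepDecomp

namespace RepCoreCarrier

section General

variable {H HG CG G SK SigIdxG : Type}
variable [NormedAddCommGroup H] [InnerProductSpace ℂ H] [CompleteSpace H]
variable [NormedAddCommGroup HG] [InnerProductSpace ℂ HG] [CompleteSpace HG]
variable [NormedAddCommGroup CG] [NormedSpace ℂ CG]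
variable [Group G] [TopologicalSpace G] [TopologicalSpace SK]
variable (C : RepCoreCarrier H HG CG G SK SigIdxG)

/-- **The core axioms with the compactness input in its PRINT form**: unitarity and strong continuity of `R`, a Dirac
datum on `U(W)(𝔸)` whose integrated operators `R(f_n)` are COMPACT, and the `G_U`-side completeness. -/
structure AnalyticD : Prop where
  /-- AX9 (l. 382–383): `R` is unitary. -/
  R_unitary : ∀ (g : G) (u v : H), ⟪C.R g u, C.R g v⟫_ℂ = ⟪u, v⟫_ℂ
  /-- `R` is strongly continuous.  J. R. Getz, H. Hahn, GTM 300 (2024), §3.1, p. 55, Theorem 3.1.1, verbatim: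
  "Assume one has a continuous right action `X × G → X, (x, g) ↦ xg` where `X` is a locally compact Hausdorff space
  equipped with a `G`-invariant Radon measure `dx`. … We obtain a left action of `G` on `L²(X, dx)` via
  `π(g)φ(x) := φ(xg)` (3.3).  Theorem 3.1.1 The action of `G` on `L²(X, dx)` defined as in (3.3) is continuous."
  (For the `L²`/Koopman model this is Mathlib's `MeasureTheory.Lp.instContinuousSMulDomMulAct`, see
  `RepCoreCarrier.stronglyContinuous_koopman` and `AnalyticL2D`.) -/
  R_continuous : RepDecomp.StronglyContinuous C.R
  /-- **COMPACTNESS OF `R(f_n)`** — the one cited input.  There is a Dirac datum `d` on `U(W)(𝔸)` (Borel structure,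
  Haar measure, Dirac sequence `{f_n}`: [Getz–Hahn 2024, §9.3 p. 179 (a)(b)(c)], "It is not difficult to see that a
  Dirac sequence on `G(𝔸_F)¹` exists (Exercise 9.7)") all of whose integrated operators
  `R(f_n) v = ∫ f_n(g) R(g) v dg` are COMPACT: J. R. Getz, H. Hahn, *An Introduction to Automorphic Representations*,
  GTM 300 (2024), Theorem 9.1.1 (Gelfand and Piatetski-Shapiro), p. 174, verbatim: "The subspace
  `L²_cusp([G]) ≤ L²([G])` is closed and `R_cusp(f)` is of trace class for all `f ∈ C_c^∞(G(𝔸_F)¹)`."  For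
  `G = Res_{L₀/ℚ} U(W)` with `W` anisotropic (definite at `ι₁`; PerL v5 l. 384 "[U(W)] is compact") there is no
  proper parabolic subgroup, so `L²_cusp([G]) = L²([G])`, `G(𝔸_F)¹ = G(𝔸_F)`, and trace class ⇒ compact.  (The
  Dirac functions may be taken smooth at the archimedean places and locally constant at the finite ones, so that
  `f_n ∈ C_c^∞`.) -/
  dirac_compact : ∃ d : RepDecomp.DiracDatum G, ∀ n, IsCompactOperator (d.opFun C.R n)
  /-- AX1b(a): completeness of the `G_U`-side decomposition (unchanged). -/
  hatτ_complete : (⨆ j, C.hatτ j).topologicalClosure = ⊤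

variable {C}

/-- **`AnalyticD → AnalyticK`**: the compact approximation is CONSTRUCTED (`RepDecomp.hasCompactApprox_of_dirac`). -/
theorem AnalyticD.toAnalyticK (h : C.AnalyticD) : C.AnalyticK where
  R_unitary := h.R_unitary
  compactApprox := by
    obtain ⟨d, hd⟩ := h.dirac_compact
    exact d.hasCompactApprox h.R_unitary h.R_continuous hd
  hatτ_complete := h.hatτ_complete

/-- (Ported verbatim from the HodgeCMPerL package; no docstring in the source.) -/
theorem AnalyticD.toAnalytic (h : C.AnalyticD) : C.Analytic :=
  h.toAnalyticK.toAnalytic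

end General

section Koopman

variable {X : Type} [TopologicalSpace X] [R1Space X] [MeasurableSpace X] [BorelSpace X] {μ : Measure X}
  [IsLocallyFiniteMeasure μ] [μ.InnerRegularCompactLTTop]
variable {M : Type} [Group M] [TopologicalSpace M] [MeasurableSpace M] [OpensMeasurableSpace M]
  [MulAction M X] [ContinuousSMul M X] [SMulInvariantMeasure M X μ] [MeasurableConstSMul M X]
variable {HG CG SK SigIdxG : Type}
variable [NormedAddCommGroup HG] [InnerProductSpace ℂ HG] [CompleteSpace HG]
variable [NormedAddCommGroup CG] [NormedSpace ℂ CG] [TopologicalSpace SK]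


-- port_pkg: scope closed for this part
end Koopman
end RepCoreCarrier
end HodgeCM
end
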